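import Literature.Probability.Percolation.SlabRSWGluingLobe
import HarnessLib

/-!
# Newman–Tassion–Wu 2017, §3.2 (Remark 2: rectilinear domains) — the plain surgery from PORT DATA for
# ANY gluing datum that is LOCALLY rectangular: trunk rectangle `K ⊆ S`, cleared rectangle `D ⊇ K`
# extending `K` downward inside `R`

Topic: `Literature/Probability/Percolation`. The tree's located-gadget supplies (`…_ext`, `…_segExt`,
`…_lobe`) repeat one construction: the far path enters a cleared rectangle `D`, the minimal path `Γ` is
rerouted inside a trunk rectangle `K = D ∩ S`, and the branch reaches the port either inside `K`
(`exists_route`) or through the part of `D` below `K` by an exterior L-path (`RouteSpec.append_branch`).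
This file states that construction ONCE for an arbitrary `GlueData` under purely local hypotheses (no
global shape of `S` or `R` is assumed): it is the form needed for the remaining geometries of §3.4–3.6
(L-shaped regions met away from their inner corner, blocks attached below an arm, slit domains away from
the slit), where `S` is not a rectangle but `(z + B_r) ∩ S` is.

* `GlueData.exists_surgery_rectBelow`.

## Sources

* C. M. Newman, V. Tassion, W. Wu, *Critical percolation and the minimal spanning tree in slabs*,
  Comm. Pure Appl. Math. 70 (2017), arXiv:1512.09107: §3.2, proof of Theorem 3.7, steps (1)–(3) and
  Remark 2 ("the proof also applies if the sets R and S are of the form T̄ … rectilinear domain")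
  [NewmanTassionWu2017].
-/

noncomputable section

namespace Literature.Probability.Percolation

open MeasureTheory LatticeModels SimpleGraph

namespace NTW17

variable {k : ℕ}

namespace GlueData

variable {Q : GlueData} {ω : BondConfig (slab 3 k)} {ρ : ℕ}

/-- **The plain surgery from port data, locally rectangular form.** Let `Q` be any gluing datum,
`ω ∈ 𝒳` a lattice configuration, and port data at `v` (a far open self-avoiding path from `c₀ ∈ C̄` to a
vertex `u` inside `R̄` off the `ρ`-neighbourhood of `Γ̄` — typically a lattice neighbour of `v` —, `v` within `ρ` of `Γ̄`, no
cell of `A` or `C` within `ρ + 3` of `z = planar v`). Suppose `K = [xL,xR]×[rB,rP] ⊆ S` (at least four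
columns and rows) and `D = [xL,xR]×[rD,rP] ⊆ R` (`rD ≤ rB`) lie in `z + B_{ρ+3}`, `D` meets no cell of
`B`, the cells of `S` in `D` lie in `K`, the cells of `S` within `ρ + 1` of `z` lie in `D`, and `u`
lies over `D`. Then there is a surgery with cleared set `D`.
[cite: NewmanTassionWu2017, §3.2 (proof of Theorem 3.7, steps (1)–(3); Remark 2)] -/
theorem exists_surgery_rectBelow (hk : 1 ≤ k) (hρ : 2 ≤ ρ) (hω : ω ⊆ (slabGraph 3 k).edgeSet)
    (hX : ω ∈ Q.evX k) {c₀ u v : slab 3 k} {L : List (slab 3 k)} (hc₀ : c₀ ∈ slabLift k Q.C)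
    (hL : IsOSAP k ω (slabLift k Q.R ∩ {x | ¬Near k (Q.γ k ω) ρ (planar k x)}) {c₀} {u} L)
    (hnear : Near k (Q.γ k ω) ρ (planar k v))
    (hnA : ∀ a' ∈ Q.A, a' ∉ sqBox (planar k v) (ρ + 3))
    (hnC : ∀ c' ∈ Q.C, c' ∉ sqBox (planar k v) (ρ + 3))
    {xL xR rD rB rP : ℤ} (hcols : xL + 3 ≤ xR) (hrows : rB + 3 ≤ rP) (hrDB : rD ≤ rB)
    (hKS : boxR xL xR rB rP ⊆ Q.S) (hDR : boxR xL xR rD rP ⊆ Q.R)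
    (hDbox : boxR xL xR rD rP ⊆ sqBox (planar k v) (ρ + 3))
    (hDB : ∀ w ∈ boxR xL xR rD rP, w ∉ Q.B)
    (hSK : ∀ w ∈ boxR xL xR rD rP, w ∈ Q.S → w ∈ boxR xL xR rB rP)
    (hγD : ∀ w ∈ Q.S, w ∈ sqBox (planar k v) (ρ + 1) → w ∈ boxR xL xR rD rP)
    (huD : planar k u ∈ boxR xL xR rD rP) :
    ∃ sx : Q.Surgery k ω, sx.D = boxR xL xR rD rP := by
  have hA : ω ∈ Q.evAB k := hX.1
  obtain ⟨hγO, -⟩ := Q.γ_spec hA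
  set z := planar k v with hzdef
  set D := boxR xL xR rD rP with hDdef
  set K := boxR xL xR rB rP with hKdef
  have hKD : K ⊆ D := by
    intro w hw; rw [hKdef, mem_boxR_iff] at hw; rw [hDdef, mem_boxR_iff]; omega
  have hc₀D : planar k c₀ ∉ D := fun h => hnC _ hc₀ (hDbox h)
  have hDA : ∀ w ∈ D, w ∉ Q.A := fun w hw hwA => hnA w hwA (hDbox hw)
  have memK : ∀ w : ℤ × ℤ, xL ≤ w.1 → w.1 ≤ xR → rB ≤ w.2 → w.2 ≤ rP → w ∈ K := by
    intro w h1 h2 h3 h4; rw [hKdef, mem_boxR_iff]; exact ⟨h1, h2, h3, h4⟩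
  have memD : ∀ w : ℤ × ℤ, xL ≤ w.1 → w.1 ≤ xR → rD ≤ w.2 → w.2 ≤ rP → w ∈ D := by
    intro w h1 h2 h3 h4; rw [hDdef, mem_boxR_iff]; exact ⟨h1, h2, h3, h4⟩
  have Dmem : ∀ w : ℤ × ℤ, w ∈ D → xL ≤ w.1 ∧ w.1 ≤ xR ∧ rD ≤ w.2 ∧ w.2 ≤ rP := by
    intro w hw; rw [hDdef, mem_boxR_iff] at hw; exact hw
  have notK_low : ∀ w : ℤ × ℤ, w.2 ≤ rB - 1 → w ∉ K := by
    intro w hw h; rw [hKdef, mem_boxR_iff] at h; omega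
  -- the port
  have huL : u ∈ L := by
    have := hL.last_mem hL.ne_nil
    rw [Set.mem_singleton_iff] at this
    rw [← this]; exact List.getLast_mem _
  have hheadL : L.head hL.ne_nil = c₀ := by
    have := hL.head_mem hL.ne_nil
    rwa [Set.mem_singleton_iff] at this
  have hheadD : planar k (L.head hL.ne_nil) ∉ D := by rw [hheadL]; exact hc₀D
  obtain ⟨m, w', rest, hm, hLeq, hmD, hw'D, hedge, -, hmhead, hconn, -⟩ :=
    exists_entry (R := Q.R) hL.chain hL.nodup (fun x hx => (hL.subset x hx).1) hL.ne_nil hheadD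
      ⟨u, huL, huD⟩
  rw [hheadL] at hconn
  set q₁ := m.getLast hm with hq₁
  have hadj : (slabGraph 3 k).Adj w' q₁ := ((SimpleGraph.mem_edgeSet _).1 (hω hedge)).symm
  have hq₁D : planar k q₁ ∉ D := hmD _ (List.getLast_mem hm)
  have hσ : ω ∈ openConnIn (slabLift k (Q.R \ D)) q₁ c₀ := openConnIn_reverse hconn
  have hw'L : w' ∈ L := by rw [hLeq]; simp
  have hw'far : ¬Near k (Q.γ k ω) ρ (planar k w') := (hL.subset w' hw'L).2
  have hw'R : planar k w' ∈ Q.R := (hL.subset w' hw'L).1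
  -- two vertices of `γ` over `D`
  obtain ⟨g₀, hg₀, hz⟩ := hnear
  have hg₀z : planar k g₀ ∈ sqBox z ρ := GlueGeom.mem_sqBox_comm hz
  have hg₀h := ne_head_of_far_A (Q := Q) hA hz (by omega : ρ ≤ ρ + 3) hnA
  obtain ⟨g₁, hg₁γ, hadj₀, hg₁ne, -⟩ := exists_pred hω hA hg₀ hg₀h
  have hg₀D : planar k g₀ ∈ D := hγD _ (hγO.subset g₀ hg₀) (sqBox_mono _ (by omega) hg₀z)
  have hg₁D : planar k g₁ ∈ D :=
    hγD _ (hγO.subset g₁ hg₁γ) (mem_sqBox_add hg₀z (planar_mem_sqBox_one_of_adj hadj₀.symm))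
  have htwo : ∃ x ∈ Q.γ k ω, ∃ y ∈ Q.γ k ω, x ≠ y ∧ planar k x ∈ D ∧ planar k y ∈ D :=
    ⟨g₁, hg₁γ, g₀, hg₀, hg₁ne, hg₁D, hg₀D⟩
  have hγK : ∀ x ∈ Q.γ k ω, planar k x ∈ D → planar k x ∈ K := fun x hx hxD =>
    hSK _ hxD (hγO.subset x hx)
  -- routing
  have hroute : ∀ E₁ E₂ : slab 3 k, E₁ ∈ Q.γ k ω → E₂ ∈ Q.γ k ω → E₁ ≠ E₂ →
      planar k E₁ ∈ D → planar k E₂ ∈ D → ∃ Lr Br c, RouteSpec k K D E₁ E₂ w' Lr Br c := by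
    intro E₁ E₂ hE₁ hE₂ hne hE₁D hE₂D
    have hE₁K := hγK E₁ hE₁ hE₁D
    have hE₂K := hγK E₂ hE₂ hE₂D
    have h0 : ¬Near k (Q.γ k ω) 0 (planar k w') := fun hn => hw'far (hn.mono (by omega))
    by_cases hw'K : planar k w' ∈ K
    · obtain ⟨Lr, Br, c, spec⟩ := exists_route (xL := xL) (xR' := xR) (xR := xR) (rB := rB) (rP := rP)
        (rT := rP) hk (by omega) le_rfl hrows le_rfl hE₁K hE₂K hw'K hne
        (ne_planar_of_not_near h0 hE₁).symm (ne_planar_of_not_near h0 hE₂).symm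
      exact ⟨Lr, Br, c, RouteSpec.mono spec subset_rfl hKD⟩
    · -- the port lies below the trunk box: anchor on the row `rB`, exterior L-path below
      set ew := planar k w' with hewdef
      obtain ⟨hw1, hw2, hw3, hw4⟩ := Dmem _ hw'D
      have hlow : ew.2 ≤ rB - 1 := by
        by_contra hcon
        exact hw'K (memK _ hw1 hw2 (by omega) hw4)
      set e₁ := planar k E₁ with he₁def
      set e₂ := planar k E₂ with he₂def
      set h : ℕ := ht w' with hhdef
      have hhk : h ≤ k := ht_le w'
      obtain ⟨xa, hxa1, hxa2, hxae₁, hxae₂, -⟩ :=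
        exists_row_avoid (rB := xL) (rP := xL + 3) (by omega) e₁.1 e₂.1 e₁.1
      set w'' : slab 3 k := vtx k (xa, rB) h with hw''def
      have hw''p : planar k w'' = (xa, rB) := planar_vtx _ _
      have hw''K : planar k w'' ∈ K := by
        rw [hw''p]; refine memK _ ?_ ?_ ?_ ?_ <;> dsimp only <;> omega
      have hE₁w'' : planar k E₁ ≠ planar k w'' := by
        intro hE; have := congrArg Prod.fst hE; rw [hw''p] at this; exact hxae₁ this.symm
      have hE₂w'' : planar k E₂ ≠ planar k w'' := by
        intro hE; have := congrArg Prod.fst hE; rw [hw''p] at this; exact hxae₂ this.symm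
      obtain ⟨Lr, Br, c, spec⟩ := exists_route (xL := xL) (xR' := xR) (xR := xR) (rB := rB) (rP := rP)
        (rT := rP) hk (by omega) le_rfl hrows le_rfl hE₁K hE₂K hw''K hne hE₁w'' hE₂w''
      have spec' : RouteSpec k K D E₁ E₂ w'' Lr Br c := RouteSpec.mono spec subset_rfl hKD
      obtain ⟨lp, hlp, hlpmem⟩ := exists_lpath_hv ((xa, rB - 1) : ℤ × ℤ) ew
      set X : List (slab 3 k) := liftH k h lp with hXdef
      have hXne : X ≠ [] := liftH_ne_nil hlp.ne_nil
      have hXlow : ∀ x ∈ X, (planar k x).2 ≤ rB - 1 := by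
        intro x hx
        rw [hXdef, mem_liftH_iff hhk] at hx
        rcases (hlpmem _).1 hx.1 with ⟨h1, -, -⟩ | ⟨-, -, h3⟩
        · simp only at h1; omega
        · simp only at h3; rw [max_def] at h3; split_ifs at h3 <;> omega
      have hXK : ∀ x ∈ X, planar k x ∉ K := fun x hx => notK_low _ (hXlow x hx)
      have hXD : ∀ x ∈ X, planar k x ∈ D := by
        intro x hx
        rw [hXdef, mem_liftH_iff hhk] at hx
        rcases (hlpmem _).1 hx.1 with ⟨h1, h2, h3⟩ | ⟨h1, h2, h3⟩
        · simp only at h1 h2 h3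
          refine memD _ ?_ ?_ ?_ ?_ <;>
            · rw [min_def] at h2; rw [max_def] at h3; split_ifs at h2 h3 <;> omega
        · simp only at h1 h2 h3
          refine memD _ ?_ ?_ ?_ ?_ <;>
            · rw [min_def] at h2; rw [max_def] at h3; split_ifs at h2 h3 <;> omega
      have hXhead : X.head? = some (vtx k (xa, rB - 1) h) := by
        rw [hXdef, head?_liftH, hlp.head]; rfl
      have hXlast : X.getLast hXne = w' := by
        apply Option.some_injective
        rw [← List.getLast?_eq_some_getLast, hXdef, getLast?_liftH, hlp.last]
        simp [hewdef, hhdef, vtx_planar_ht]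
      have hchX : (w'' :: X).IsChain (fun a b => (slabGraph 3 k).Adj a b) := by
        rw [List.isChain_cons]
        refine ⟨fun y hy => ?_, liftH_isChain h hlp.chain⟩
        rw [hXhead] at hy
        simp only [Option.mem_def, Option.some.injEq] at hy
        rw [← hy, hw''def]
        refine vtx_adj_vtx_planar ?_ h
        right; right; ext <;> simp
      have hXL : ∀ x ∈ X, x ∉ Lr := fun x hx hm => hXK x hx (spec.hL_sub x hm)
      have hXBr : ∀ x ∈ X, x ∉ c :: Br := by
        intro x hx hm
        rcases List.mem_cons.1 hm with hm | hm
        · exact hXK x hx (hm ▸ spec.hL_sub c spec.hc)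
        · exact hXK x hx (spec.hBr_sub x hm)
      have spec₂ := RouteSpec.append_branch X w'' Br hXne spec' hchX (liftH_nodup hlp.nodup) hXL hXBr hXD
      rw [hXlast] at spec₂
      exact ⟨Lr, Br ++ X, c, spec₂⟩
  exact exists_surgery_of_route (Q := Q) hX hDR hDA hDB hKD hKS htwo hadj hq₁D hc₀ hσ hroute

end GlueData

end NTW17

end Literature.Probability.Percolation

end
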